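import Summits.QuantumFields.YangMills.Theorems.CovariantDischargeAvgPlaqFluxLinearIter
import Literature.MathematicalPhysics.QuantumFieldTheory.Balaban1983to89.T4ExpWindowSmallField
import HarnessLib

/-!
# Crux `HistoryTailL` (stmt-QuantumFields-19936) — THE `SU(2)` READING OF THE FLUX-LINEAR AVERAGE: `⟪v, imVec(su2Quat ·)⟫` is EXACTLY linear in
# `g − 1`, so the window statistic of the `j`-fold averaged plaquette is the linear reading of `L^j·(Q_j(W−1))(∂p)` up to `√3·E_j`
# (brick (M3) of the LOCATE «B3» for the capped sweep stub `stub_sandwichSweepGapCapped` of the ledger skeleton v5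
# `Cruxes/HistoryTailL/Lines/sandwich_discharge.lean`; text-independent of that stub)

Cell `ym3-torus` (YM ladder rung R3 = continuum SU(2) Yang–Mills on the three-torus; NOT the Clay problem), width seat `ym-ust-19936-w5` gen 13.

THE POINT.  The sandwich ∕ window events of the sweep lines read the averaged plaquette `H = Ū^{(j)}(∂p) ∈ SU(2)` through `⟪v, imVec(su2Quat H)⟫`
(`su2Quat H = (Re H₀₀, Im H₀₀, Re H₀₁, Im H₀₁)`, `imVec = (imI, imJ, imK)`).  This is an ℝ-LINEAR functional of the matrix `H − 1` with NO remainder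
(§1 `inner_imVec_su2Quat_eq`: `= v₀·Im(H−1)₀₀ + v₁·Re(H−1)₀₁ + v₂·Im(H−1)₀₁`), bounded by `(|v₀|+|v₁|+|v₂|)·‖H − 1‖ ≤ √3‖v‖·‖H − 1‖` (§1); hence (M2)
✓`CovariantDischargeAvgPlaqFluxLinearIter.iter_plaqHol_flux_linear` yields §2 `reading_iter_plaqHol_flux_linear`:
`|⟪v, imVec(su2Quat(Ū^{(j)}[W](∂p)))⟫ − READ_v(L^j·(Q_j(W−1))(∂p))| ≤ (|v₀|+|v₁|+|v₂|)·E_j` — px8 #53's B3 text «`⟪v, imVec(su2Quat(plaqHol(Ū^j V) p))⟫ =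
Σ_q w^{(j)}_q(p)·f_v(q) + O(·)`» with `READ_v` the same linear reading applied to the flux mean.

WHAT THIS IS NOT.  Elementary linear algebra on `M₂(ℂ)`; nothing of the capped sweep stub, `HistoryTailL` or the rung is proved.  YM₃ on T³ is rung R3, NOT Clay.

References: T. Bałaban, CMP **98** (1985) 17–51 [Balaban1985Averaging] ((19)–(20) p.21, Prop. 1 (51) p.26); CMP **109** (1987) 249–301 [Balaban1987RG1] ((0.11) p.253).
-/

noncomputable section

open scoped BigOperators Matrix.Norms.L2Operator RealInnerProductSpace

namespace Summit.QuantumFields.YangMills.Theorems.CovariantDischargeAvgPlaqFluxReading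

open Literature.MathematicalPhysics.QuantumFieldTheory.Balaban1983to89
open Literature.MathematicalPhysics.QuantumLattice (su2Quat)
open Literature.MathematicalPhysics.QuantumFieldTheory.Balaban1983to89.T4ExpWindowSmallField (imVec)
open T4Continuum BlockAveraging LatticeFieldCalculus ExpMeanLog
open Summit.QuantumFields.YangMills.Theorems.CovariantDischargeAvgPlaqFluxLinearIter (iter_plaqHol_flux_linear
  iter_plaqHol_flux_linear_geometric)

/-! ## §1 The reading is exactly linear in `g − 1` -/

section Reading

/-- Entry bound under the `L²`-operator norm: `‖A i j‖ ≤ ‖A‖` (local copy of a folklore letter kept private in several tree files). [folklore] -/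
private theorem norm_entry_le_l2_opNorm {m n : Type*} [Fintype m] [Fintype n] [DecidableEq n] (A : Matrix m n ℂ) (i : m) (j : n) :
    ‖A i j‖ ≤ ‖A‖ := by
  have h := Matrix.l2_opNorm_mulVec A (EuclideanSpace.single j (1 : ℂ))
  rw [PiLp.norm_single, norm_one, mul_one] at h
  refine le_trans ?_ h
  have hc := PiLp.norm_apply_le ((EuclideanSpace.equiv m ℂ).symm (A.mulVec (EuclideanSpace.single j (1 : ℂ)).ofLp)) i
  have hij : ((EuclideanSpace.equiv m ℂ).symm (A.mulVec (EuclideanSpace.single j (1 : ℂ)).ofLp)) i = A i j := by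
    simp
  rw [hij] at hc
  exact hc

/-- **THE READING IS EXACTLY LINEAR IN `g − 1`**: `⟪v, imVec(su2Quat g)⟫ = v₀·Im(g−1)₀₀ + v₁·Re(g−1)₀₁ + v₂·Im(g−1)₀₁` for `g ∈ SU(2)` (the identity matrix has
real diagonal and zero off-diagonal). [folklore] -/
theorem inner_imVec_su2Quat_eq (v : EuclideanSpace ℝ (Fin 3)) (g : Matrix.specialUnitaryGroup (Fin 2) ℂ) :
    ⟪v, imVec (su2Quat g)⟫ =
      v 0 * (((g : Matrix (Fin 2) (Fin 2) ℂ) - 1) 0 0).im + v 1 * (((g : Matrix (Fin 2) (Fin 2) ℂ) - 1) 0 1).re +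
        v 2 * (((g : Matrix (Fin 2) (Fin 2) ℂ) - 1) 0 1).im := by
  rw [real_inner_comm, EuclideanSpace.inner_eq_star_dotProduct]
  simp [imVec, su2Quat, dotProduct, Fin.sum_univ_three]

/-- The linear reading of a matrix is bounded by `(|v₀|+|v₁|+|v₂|)·‖M‖` (entries are bounded by the operator norm). [folklore] -/
theorem abs_reading_le (v : EuclideanSpace ℝ (Fin 3)) (M : Matrix (Fin 2) (Fin 2) ℂ) :
    |v 0 * (M 0 0).im + v 1 * (M 0 1).re + v 2 * (M 0 1).im| ≤ (|v 0| + |v 1| + |v 2|) * ‖M‖ := by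
  have h00 : |(M 0 0).im| ≤ ‖M‖ := (Complex.abs_im_le_norm _).trans (norm_entry_le_l2_opNorm M 0 0)
  have h01r : |(M 0 1).re| ≤ ‖M‖ := (Complex.abs_re_le_norm _).trans (norm_entry_le_l2_opNorm M 0 1)
  have h01i : |(M 0 1).im| ≤ ‖M‖ := (Complex.abs_im_le_norm _).trans (norm_entry_le_l2_opNorm M 0 1)
  calc |v 0 * (M 0 0).im + v 1 * (M 0 1).re + v 2 * (M 0 1).im|
      ≤ |v 0 * (M 0 0).im| + |v 1 * (M 0 1).re| + |v 2 * (M 0 1).im| := abs_add_three _ _ _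
    _ = |v 0| * |(M 0 0).im| + |v 1| * |(M 0 1).re| + |v 2| * |(M 0 1).im| := by rw [abs_mul, abs_mul, abs_mul]
    _ ≤ |v 0| * ‖M‖ + |v 1| * ‖M‖ + |v 2| * ‖M‖ :=
        add_le_add (add_le_add (mul_le_mul_of_nonneg_left h00 (abs_nonneg _)) (mul_le_mul_of_nonneg_left h01r (abs_nonneg _)))
          (mul_le_mul_of_nonneg_left h01i (abs_nonneg _))
    _ = (|v 0| + |v 1| + |v 2|) * ‖M‖ := by ring

/-- `|v₀|+|v₁|+|v₂| ≤ √3·‖v‖` (Cauchy–Schwarz in `ℝ³`). [folklore] -/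
theorem sum_abs_le_sqrt_three_mul_norm (v : EuclideanSpace ℝ (Fin 3)) : |v 0| + |v 1| + |v 2| ≤ Real.sqrt 3 * ‖v‖ := by
  have hn : ‖v‖ ^ 2 = v 0 ^ 2 + v 1 ^ 2 + v 2 ^ 2 := by
    rw [EuclideanSpace.real_norm_sq_eq, Fin.sum_univ_three]
  have h3 : (|v 0| + |v 1| + |v 2|) ^ 2 ≤ 3 * ‖v‖ ^ 2 := by
    rw [hn, ← sq_abs (v 0), ← sq_abs (v 1), ← sq_abs (v 2)]
    nlinarith [sq_nonneg (|v 0| - |v 1|), sq_nonneg (|v 1| - |v 2|), sq_nonneg (|v 0| - |v 2|)]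
  have hs : Real.sqrt 3 * ‖v‖ = Real.sqrt (3 * ‖v‖ ^ 2) := by
    rw [Real.sqrt_mul (by norm_num), Real.sqrt_sq (norm_nonneg _)]
  rw [hs]
  exact Real.le_sqrt_of_sq_le h3

/-- **THE READING OF A NEAR-IDENTITY ELEMENT THROUGH AN APPROXIMATION OF `g − 1`**: if `‖(g − 1) − M‖ ≤ ε` then
`|⟪v, imVec(su2Quat g)⟫ − (v₀·Im M₀₀ + v₁·Re M₀₁ + v₂·Im M₀₁)| ≤ (|v₀|+|v₁|+|v₂|)·ε`. [folklore] -/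
theorem abs_inner_imVec_su2Quat_sub_reading_le (v : EuclideanSpace ℝ (Fin 3)) (g : Matrix.specialUnitaryGroup (Fin 2) ℂ)
    (M : Matrix (Fin 2) (Fin 2) ℂ) {ε : ℝ} (h : ‖(g : Matrix (Fin 2) (Fin 2) ℂ) - 1 - M‖ ≤ ε) :
    |⟪v, imVec (su2Quat g)⟫ - (v 0 * (M 0 0).im + v 1 * (M 0 1).re + v 2 * (M 0 1).im)| ≤ (|v 0| + |v 1| + |v 2|) * ε := by
  rw [inner_imVec_su2Quat_eq]
  set D : Matrix (Fin 2) (Fin 2) ℂ := (g : Matrix (Fin 2) (Fin 2) ℂ) - 1 - M with hD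
  have e : v 0 * (((g : Matrix (Fin 2) (Fin 2) ℂ) - 1) 0 0).im + v 1 * (((g : Matrix (Fin 2) (Fin 2) ℂ) - 1) 0 1).re +
        v 2 * (((g : Matrix (Fin 2) (Fin 2) ℂ) - 1) 0 1).im - (v 0 * (M 0 0).im + v 1 * (M 0 1).re + v 2 * (M 0 1).im) =
      v 0 * (D 0 0).im + v 1 * (D 0 1).re + v 2 * (D 0 1).im := by
    simp only [hD, Matrix.sub_apply, Complex.sub_im, Complex.sub_re]
    ring
  rw [e]
  exact (abs_reading_le v D).trans (mul_le_mul_of_nonneg_left h (by positivity))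

end Reading

/-! ## §2 The window statistic of the `j`-fold average is the reading of the flux mean -/

section Main

variable {P : Params}

/-- ★★★ **THE `SU(2)` READING OF THE FLUX-LINEAR AVERAGE** (B3 of `LOCATE-SWGAP-px8g6` §4, modulo the consumer's localisation): under the hypotheses of
✓`iter_plaqHol_flux_linear` (`W` in the flat chart `‖W_b − 1‖ ≤ s 0`, recursion majorants `s, E`, guards, `j ≤ m + K`), for every plaquette `p` of `T^{(j)}` and
every `v ∈ ℝ³`:
`|⟪v, imVec(su2Quat(Ū^{(j)}[W](∂p)))⟫ − READ_v(L^j·((Q_j(W−1))(c₁) + (Q_j(W−1))(c₂) − (Q_j(W−1))(c₃) − (Q_j(W−1))(c₄)))| ≤ (|v₀|+|v₁|+|v₂|)·E_j`,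
`READ_v(M) = v₀·Im M₀₀ + v₁·Re M₀₁ + v₂·Im M₀₁` — the window statistic is the linear reading of `(L^j)²` × the mean fine flux over the translated-square
family, to second order. [cite: Balaban1985Averaging, Prop. 1 (51) p.26 and Prop. 4 (134)-(135) p.38; Balaban1987RG1, (0.11) p.253] -/
theorem reading_iter_plaqHol_flux_linear {j : ℕ} (hj : j ≤ P.m + P.K) (W : GaugeField P 0 (Matrix.specialUnitaryGroup (Fin 2) ℂ))
    (s E : ℕ → ℝ) (hs0 : ∀ i, 0 ≤ s i)
    (hW : ∀ b, ‖((W b : Matrix.specialUnitaryGroup (Fin 2) ℂ) : Matrix (Fin 2) (Fin 2) ℂ) - 1‖ ≤ s 0)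
    (h16 : ∀ i, i ≤ j → 16 * ((((P.d + 2) * P.L : ℕ) : ℝ) * s i) ≤ 1)
    (hN : ∀ i, i < j → 2 * ((((P.d + 2) * P.L : ℕ) : ℝ) * s i) < deltaSU (Fin 2))
    (hsrec : ∀ i, i < j → 3 * ((((P.d + 2) * P.L : ℕ) : ℝ) * s i) + 81 * ((((P.d + 2) * P.L : ℕ) : ℝ) * s i) ^ 2 ≤ s (i + 1))
    (hE0 : 13 * s 0 ^ 2 ≤ E 0)
    (hErec : ∀ i, i < j → (P.L : ℝ) ^ 2 * E i + (1377 * ((((P.d + 2) * P.L : ℕ) : ℝ) * s i) ^ 2 + (P.L : ℝ) ^ 2 * (13 * s i ^ 2)) ≤ E (i + 1))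
    (p : Plaq P j) (v : EuclideanSpace ℝ (Fin 3)) :
    |⟪v, imVec (su2Quat (GaugeField.plaqHol
          (Averaging.iter (fun i => BlockAveraging.blockAvg (P := P) (j := i) (expMeanLogSU (n := Fin 2))) j W) p))⟫ -
        (v 0 * ((((P.L : ℝ) ^ j) • (bondAvgIter j (fun b => ((W b : Matrix.specialUnitaryGroup (Fin 2) ℂ) : Matrix (Fin 2) (Fin 2) ℂ) - 1)
              ⟨p.src, p.μ⟩ +
            bondAvgIter j (fun b => ((W b : Matrix.specialUnitaryGroup (Fin 2) ℂ) : Matrix (Fin 2) (Fin 2) ℂ) - 1) ⟨p.src.shift p.μ, p.ν⟩ -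
            bondAvgIter j (fun b => ((W b : Matrix.specialUnitaryGroup (Fin 2) ℂ) : Matrix (Fin 2) (Fin 2) ℂ) - 1) ⟨p.src.shift p.ν, p.μ⟩ -
            bondAvgIter j (fun b => ((W b : Matrix.specialUnitaryGroup (Fin 2) ℂ) : Matrix (Fin 2) (Fin 2) ℂ) - 1) ⟨p.src, p.ν⟩)) 0 0).im +
          v 1 * ((((P.L : ℝ) ^ j) • (bondAvgIter j (fun b => ((W b : Matrix.specialUnitaryGroup (Fin 2) ℂ) : Matrix (Fin 2) (Fin 2) ℂ) - 1)
              ⟨p.src, p.μ⟩ +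
            bondAvgIter j (fun b => ((W b : Matrix.specialUnitaryGroup (Fin 2) ℂ) : Matrix (Fin 2) (Fin 2) ℂ) - 1) ⟨p.src.shift p.μ, p.ν⟩ -
            bondAvgIter j (fun b => ((W b : Matrix.specialUnitaryGroup (Fin 2) ℂ) : Matrix (Fin 2) (Fin 2) ℂ) - 1) ⟨p.src.shift p.ν, p.μ⟩ -
            bondAvgIter j (fun b => ((W b : Matrix.specialUnitaryGroup (Fin 2) ℂ) : Matrix (Fin 2) (Fin 2) ℂ) - 1) ⟨p.src, p.ν⟩)) 0 1).re +
          v 2 * ((((P.L : ℝ) ^ j) • (bondAvgIter j (fun b => ((W b : Matrix.specialUnitaryGroup (Fin 2) ℂ) : Matrix (Fin 2) (Fin 2) ℂ) - 1)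
              ⟨p.src, p.μ⟩ +
            bondAvgIter j (fun b => ((W b : Matrix.specialUnitaryGroup (Fin 2) ℂ) : Matrix (Fin 2) (Fin 2) ℂ) - 1) ⟨p.src.shift p.μ, p.ν⟩ -
            bondAvgIter j (fun b => ((W b : Matrix.specialUnitaryGroup (Fin 2) ℂ) : Matrix (Fin 2) (Fin 2) ℂ) - 1) ⟨p.src.shift p.ν, p.μ⟩ -
            bondAvgIter j (fun b => ((W b : Matrix.specialUnitaryGroup (Fin 2) ℂ) : Matrix (Fin 2) (Fin 2) ℂ) - 1) ⟨p.src, p.ν⟩)) 0 1).im)| ≤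
      (|v 0| + |v 1| + |v 2|) * E j := by
  obtain ⟨_, hB⟩ := iter_plaqHol_flux_linear (n := Fin 2) j hj W s E hs0 hW h16 hN hsrec hE0 hErec
  exact abs_inner_imVec_su2Quat_sub_reading_le v _ _ (hB p)


/-- ★★ **GEOMETRIC FORM** (over ✓`iter_plaqHol_flux_linear_geometric`): `‖W_b − 1‖ ≤ s₀` on every bond, `81ℓ(4ℓ)^j s₀ ≤ 1`, `2ℓ(4ℓ)^j s₀ < δ₂`, `j ≤ m + K` ⟹
for every plaquette `p` of `T^{(j)}` and every `v ∈ ℝ³`,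
`|⟪v, imVec(su2Quat(Ū^{(j)}[W](∂p)))⟫ − READ_v(L^j·circ(Q_j(W−1))(p))| ≤ (|v₀|+|v₁|+|v₂|)·100·(4ℓ)^{2j}·s₀²`.
[cite: Balaban1985Averaging, Prop. 1 (51) p.26 and Prop. 4 (134)-(135) p.38] -/
theorem reading_iter_plaqHol_flux_linear_geometric {j : ℕ} (hj : j ≤ P.m + P.K) (W : GaugeField P 0 (Matrix.specialUnitaryGroup (Fin 2) ℂ))
    {s₀ : ℝ} (hs₀ : 0 ≤ s₀) (hW : ∀ b, ‖((W b : Matrix.specialUnitaryGroup (Fin 2) ℂ) : Matrix (Fin 2) (Fin 2) ℂ) - 1‖ ≤ s₀)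
    (h81 : 81 * (((P.d + 2) * P.L : ℕ) : ℝ) * ((4 * (((P.d + 2) * P.L : ℕ) : ℝ)) ^ j * s₀) ≤ 1)
    (hN : 2 * ((((P.d + 2) * P.L : ℕ) : ℝ) * ((4 * (((P.d + 2) * P.L : ℕ) : ℝ)) ^ j * s₀)) < deltaSU (Fin 2))
    (p : Plaq P j) (v : EuclideanSpace ℝ (Fin 3)) :
    |⟪v, imVec (su2Quat (GaugeField.plaqHol
          (Averaging.iter (fun i => BlockAveraging.blockAvg (P := P) (j := i) (expMeanLogSU (n := Fin 2))) j W) p))⟫ -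
        (v 0 * ((((P.L : ℝ) ^ j) • (bondAvgIter j (fun b => ((W b : Matrix.specialUnitaryGroup (Fin 2) ℂ) : Matrix (Fin 2) (Fin 2) ℂ) - 1)
              ⟨p.src, p.μ⟩ +
            bondAvgIter j (fun b => ((W b : Matrix.specialUnitaryGroup (Fin 2) ℂ) : Matrix (Fin 2) (Fin 2) ℂ) - 1) ⟨p.src.shift p.μ, p.ν⟩ -
            bondAvgIter j (fun b => ((W b : Matrix.specialUnitaryGroup (Fin 2) ℂ) : Matrix (Fin 2) (Fin 2) ℂ) - 1) ⟨p.src.shift p.ν, p.μ⟩ -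
            bondAvgIter j (fun b => ((W b : Matrix.specialUnitaryGroup (Fin 2) ℂ) : Matrix (Fin 2) (Fin 2) ℂ) - 1) ⟨p.src, p.ν⟩)) 0 0).im +
          v 1 * ((((P.L : ℝ) ^ j) • (bondAvgIter j (fun b => ((W b : Matrix.specialUnitaryGroup (Fin 2) ℂ) : Matrix (Fin 2) (Fin 2) ℂ) - 1)
              ⟨p.src, p.μ⟩ +
            bondAvgIter j (fun b => ((W b : Matrix.specialUnitaryGroup (Fin 2) ℂ) : Matrix (Fin 2) (Fin 2) ℂ) - 1) ⟨p.src.shift p.μ, p.ν⟩ -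
            bondAvgIter j (fun b => ((W b : Matrix.specialUnitaryGroup (Fin 2) ℂ) : Matrix (Fin 2) (Fin 2) ℂ) - 1) ⟨p.src.shift p.ν, p.μ⟩ -
            bondAvgIter j (fun b => ((W b : Matrix.specialUnitaryGroup (Fin 2) ℂ) : Matrix (Fin 2) (Fin 2) ℂ) - 1) ⟨p.src, p.ν⟩)) 0 1).re +
          v 2 * ((((P.L : ℝ) ^ j) • (bondAvgIter j (fun b => ((W b : Matrix.specialUnitaryGroup (Fin 2) ℂ) : Matrix (Fin 2) (Fin 2) ℂ) - 1)
              ⟨p.src, p.μ⟩ +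
            bondAvgIter j (fun b => ((W b : Matrix.specialUnitaryGroup (Fin 2) ℂ) : Matrix (Fin 2) (Fin 2) ℂ) - 1) ⟨p.src.shift p.μ, p.ν⟩ -
            bondAvgIter j (fun b => ((W b : Matrix.specialUnitaryGroup (Fin 2) ℂ) : Matrix (Fin 2) (Fin 2) ℂ) - 1) ⟨p.src.shift p.ν, p.μ⟩ -
            bondAvgIter j (fun b => ((W b : Matrix.specialUnitaryGroup (Fin 2) ℂ) : Matrix (Fin 2) (Fin 2) ℂ) - 1) ⟨p.src, p.ν⟩)) 0 1).im)| ≤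
      (|v 0| + |v 1| + |v 2|) * (100 * ((4 * (((P.d + 2) * P.L : ℕ) : ℝ)) ^ j) ^ 2 * s₀ ^ 2) := by
  obtain ⟨_, hB⟩ := iter_plaqHol_flux_linear_geometric (n := Fin 2) hj W hs₀ hW h81 hN
  exact abs_inner_imVec_su2Quat_sub_reading_le v _ _ (hB p)

end Main

end Summit.QuantumFields.YangMills.Theorems.CovariantDischargeAvgPlaqFluxReading

end
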